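import Summits.HodgeConjecture.HodgeConjecture.Theorems.Ring2WeilCoverageCMFieldRationalClassesDFour
import HarnessLib

/-!
# Ring 2 — Weil-family coverage, CM-field rows: THE DYADIC PLACE OF THE NON-GALOIS TABLE `E = ℚ(√-(3+√2))` IN CLOSED
  FORM — `(√2) ∈ T(ℓ) ⟺ ℓ ≡ 3 (mod 4)` (WEIL-FAMILY-COVERAGE «## b03», cell (xxi¹⁰), part 55)

research route conditional on HC_CM; not a corollary; Q11.4-sentence-2 already refuted in dim ≥ 3.

Carrier `R = S² + 6S + 7` (`θ = -3 ± √2`, `θθ' = 7`, `(θ + 3)² = 2`; `F = ℚ(√2)`, `E = F(√θ)` of type `D₄`; rows labelled by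
`T(t) = {𝔭 : (t, θ)_𝔭 = -1}`) [cite: Deligne1982HodgeCycles, §4 (1), Cor. 4.2].  Part 54 described `T(ℓ)` place by place at
every NON-dyadic place (`𝔭' ∋ θ - 1` never; `𝔭_θ ∋ θ` iff `ℓ ≡ 3, 5, 6 (mod 7)` or `ℓ = 7`; inert `ℓ`: `(ℓ)` iff `(7|ℓ) = -1`;
split `ℓ ≠ 7`: both-or-none iff `(7|ℓ) = 1`, exactly one iff `(7|ℓ) = -1`) and left the dyadic place `v₂ = (√2)` — where `E/F`
is RAMIFIED, no dyadic normalisation — to the parity of the rest (part 9).  This file closes the parity: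

* §158 parity bookkeeping (any type): `Odd |S ∖ {x}|` when `S ∖ {x}` sits inside a pair / a triple.
* §159 quadratic reciprocity in the shape needed: for a prime `ℓ ≠ 2, 7`,
  **`[(ℓ|7) = -1] XOR [(7|ℓ) = -1] ⟺ ℓ ≡ 3 (mod 4)`** (`(7|ℓ)(ℓ|7) = (-1)^{(ℓ-1)/2}`).
* §160 **`v₂ ∈ T(ℓ) ⟺ ℓ ≡ 3 (mod 4)` for EVERY prime `ℓ`** (`T(2) = ∅`; `T(7) ∖ {v₂} = {𝔭_θ}`; inert `ℓ`:
  `T(ℓ) ∖ {v₂} ⊆ {𝔭_θ, (ℓ)}`; split `ℓ`: `T(ℓ) ∖ {v₂} ⊆ {𝔭_θ, v, v'}`; then Hilbert reciprocity 71:18 and §159).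
  Local reading (not used in the proof): `(ℓ, θ)_{v₂} = (ℓ, N_{F_{v₂}/ℚ₂} θ)_{ℚ₂} = (ℓ, 7)₂ = (ℓ, -1)₂ = (-1)^{(ℓ-1)/2}`.
* §161 consequences: `T(2n) = T(n)`; **`v₂ ∈ T(n) ⟺ n ≡ 3 (mod 4)` for odd `n ≥ 1`**; for `c ∈ ℚ_{>0}`, `v₂ ∈ T(c)` iff the
  number of prime factors `ℓ ≡ 3 (mod 4)` of `num(c)·den(c)`, counted with multiplicity, is odd.
With part 54 the `T`-label of EVERY prime (indeed every positive rational) of the `D₄` table is now in closed form at every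
place of `F`.  No new definition, no named fact, no sorry; nothing about the Hodge conjecture is asserted.
-/

noncomputable section

set_option linter.dupNamespace false

open Polynomial NumberField IsDedekindDomain

namespace Summit.HodgeConjecture.HodgeConjecture.Ring2.WeilCoverageCM

open Literature.AlgebraicGeometry.Deligne1982
open Literature.AlgebraicGeometry.HodgeTheory (splitDiscriminantClassCM)
open Literature.NumberTheory.QuadraticForms

/-! ### §158 Parity bookkeeping: `S ∖ {x}` inside a pair or a triple -/

section Parity

variable {α : Type*}

/-- **Pair bookkeeping**: if `S ∖ {x} ⊆ {a, b}` with `a ≠ b` both different from `x`, then `|S ∖ {x}|` is odd iff EXACTLY ONE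
of `a`, `b` lies in `S`. [folklore] -/
theorem odd_ncard_diff_singleton_iff_of_subset_pair {S : Set α} {x a b : α} (hax : a ≠ x) (hbx : b ≠ x) (hab : a ≠ b)
    (h : S \ {x} ⊆ {a, b}) : Odd (S \ {x}).ncard ↔ Xor (a ∈ S) (b ∈ S) := by
  by_cases ha : a ∈ S <;> by_cases hb : b ∈ S
  · have hS : S \ {x} = {a, b} := h.antisymm (by
      rintro y (rfl | rfl)
      · exact ⟨ha, hax⟩
      · exact ⟨hb, hbx⟩)
    rw [hS, Set.ncard_pair hab]
    exact iff_of_false (Nat.not_odd_iff_even.2 ⟨1, rfl⟩) fun hx ↦ hx.elim (fun h1 ↦ h1.2 hb) fun h2 ↦ h2.2 ha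
  · have hS : S \ {x} = {a} := by
      refine Set.Subset.antisymm (fun y hy ↦ ?_) ?_
      · rcases h hy with rfl | rfl
        · rfl
        · exact absurd hy.1 hb
      · rintro y rfl; exact ⟨ha, hax⟩
    rw [hS, Set.ncard_singleton]
    exact iff_of_true odd_one (Or.inl ⟨ha, hb⟩)
  · have hS : S \ {x} = {b} := by
      refine Set.Subset.antisymm (fun y hy ↦ ?_) ?_
      · rcases h hy with rfl | rfl
        · exact absurd hy.1 ha
        · rfl
      · rintro y rfl; exact ⟨hb, hbx⟩
    rw [hS, Set.ncard_singleton]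
    exact iff_of_true odd_one (Or.inr ⟨hb, ha⟩)
  · have hS : S \ {x} = ∅ := Set.eq_empty_iff_forall_notMem.2 fun y hy ↦ by
      rcases h hy with rfl | rfl
      · exact ha hy.1
      · exact hb hy.1
    rw [hS, Set.ncard_empty]
    exact iff_of_false (Nat.not_odd_iff_even.2 ⟨0, rfl⟩) fun hx ↦ hx.elim (fun h1 ↦ ha h1.1) fun h2 ↦ hb h2.1

/-- **Triple bookkeeping**: if `S ∖ {x} ⊆ {a, b, c}` with `a, b, c` pairwise distinct and different from `x`, then `|S ∖ {x}|`
is odd iff an odd number of `a`, `b`, `c` lie in `S`. [folklore] -/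
theorem odd_ncard_diff_singleton_iff_of_subset_triple {S : Set α} {x a b c : α} (hax : a ≠ x) (hbx : b ≠ x) (hcx : c ≠ x)
    (hab : a ≠ b) (hac : a ≠ c) (hbc : b ≠ c) (h : S \ {x} ⊆ {a, b, c}) :
    Odd (S \ {x}).ncard ↔ Xor (a ∈ S) (Xor (b ∈ S) (c ∈ S)) := by
  by_cases ha : a ∈ S
  · -- `S ∖ {x} = {a} ∪ ((S ∖ {a}) ∖ {x})` and the pair lemma for `S ∖ {a}`
    have h' : (S \ {a}) \ {x} ⊆ {b, c} := by
      rintro y ⟨⟨hyS, hya⟩, hyx⟩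
      rcases h ⟨hyS, hyx⟩ with rfl | hbc'
      · exact absurd rfl hya
      · exact hbc'
    have hpair := odd_ncard_diff_singleton_iff_of_subset_pair (S := S \ {a}) hbx hcx hbc h'
    have hbS : b ∈ S \ {a} ↔ b ∈ S := ⟨fun hb ↦ hb.1, fun hb ↦ ⟨hb, hab.symm⟩⟩
    have hcS : c ∈ S \ {a} ↔ c ∈ S := ⟨fun hc ↦ hc.1, fun hc ↦ ⟨hc, hac.symm⟩⟩
    rw [hbS, hcS] at hpair
    have hdecomp : S \ {x} = insert a ((S \ {a}) \ {x}) := by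
      ext y
      simp only [Set.mem_insert_iff, Set.mem_sdiff, Set.mem_singleton_iff]
      constructor
      · rintro ⟨hyS, hyx⟩
        by_cases hya : y = a
        · exact Or.inl hya
        · exact Or.inr ⟨⟨hyS, hya⟩, hyx⟩
      · rintro (rfl | ⟨⟨hyS, -⟩, hyx⟩)
        · exact ⟨ha, hax⟩
        · exact ⟨hyS, hyx⟩
    have hfin : ((S \ {a}) \ {x}).Finite := (Set.toFinite ({b, c} : Set α)).subset h'
    have hnot : a ∉ (S \ {a}) \ {x} := fun hy ↦ hy.1.2 rfl
    rw [hdecomp, Set.ncard_insert_of_notMem hnot hfin, Nat.odd_add_one, hpair]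
    exact ⟨fun hn ↦ Or.inl ⟨ha, hn⟩, fun hx ↦ hx.elim (fun h1 ↦ h1.2) fun h2 ↦ absurd ha h2.2⟩
  · have h' : S \ {x} ⊆ {b, c} := by
      rintro y hy
      rcases h hy with rfl | hbc'
      · exact absurd hy.1 ha
      · exact hbc'
    rw [odd_ncard_diff_singleton_iff_of_subset_pair hbx hcx hbc h']
    constructor
    · exact fun hx ↦ Or.inr ⟨hx, ha⟩
    · rintro (⟨ha', -⟩ | ⟨hx, -⟩)
      · exact absurd ha' ha
      · exact hx

end Parity

/-! ### §159 Quadratic reciprocity in the shape needed: `[(ℓ|7) = -1] XOR [(7|ℓ) = -1] ⟺ ℓ ≡ 3 (mod 4)` -/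

/-- **For a prime `ℓ ≠ 2, 7`: exactly one of «`ℓ` is a non-square mod `7`» (`ℓ % 7 ∈ {3, 5, 6}`), «`7` is a non-square mod
`ℓ`» holds iff `ℓ ≡ 3 (mod 4)`** — quadratic reciprocity `(7|ℓ)(ℓ|7) = (-1)^{(ℓ-1)/2·3}` read through part 54's
`isSquare_seven_iff` (`(7|ℓ) = 1 ⟺ ℓ mod 28 ∈ {1, 3, 9, 19, 25, 27}`). [folklore] -/
theorem xor_nonsquare_mod_seven_not_isSquare_seven_iff {ℓ : ℕ} (hℓ : ℓ.Prime) (h2 : ℓ ≠ 2) (h7 : ℓ ≠ 7) :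
    Xor (ℓ % 7 = 3 ∨ ℓ % 7 = 5 ∨ ℓ % 7 = 6) (¬ IsSquare (7 : ZMod ℓ)) ↔ ℓ % 4 = 3 := by
  rw [isSquare_seven_iff hℓ h2 h7]
  have hodd : ℓ % 2 = 1 := (Nat.Prime.mod_two_eq_one_iff_ne_two hℓ).2 h2
  have h70 : ℓ % 7 ≠ 0 := fun h ↦ h7 ((Nat.prime_dvd_prime_iff_eq (by norm_num : (7 : ℕ).Prime) hℓ).1
    (Nat.dvd_of_mod_eq_zero h)).symm
  obtain ⟨k, r, hr, hkr⟩ : ∃ k r, r < 28 ∧ ℓ = 28 * k + r :=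
    ⟨ℓ / 28, ℓ % 28, Nat.mod_lt _ (by norm_num), (Nat.div_add_mod ℓ 28).symm⟩
  subst hkr
  unfold Xor
  interval_cases r <;> omega

variable {R : Polynomial ℤ} [Fact (Irreducible (cmPolyQ R))] [Fact (Irreducible (realPolyQ R))]

/-! ### §160 `ℚ(√-(3+√2))`: the dyadic place `v₂ = (√2)` against `T(ℓ)`, every prime `ℓ` -/

section DFourDyadic

/-- `ℚ(√-(3+√2))`: **`T(2) = ∅`** (`2 = (θ + 3)²` is a square of `F`; `[2] = [1]` in part X-V's prime classification).
[cite: Deligne1982HodgeCycles, §4 Cor. 4.2] -/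
theorem dFour_badPlaces_two (hR : R = X ^ 2 + C 6 * X + C 7) :
    badPlaces ((2 : ℕ) : realField R) (AdjoinRoot.root (realPolyQ R)) = ∅ := by
  have h0 : ((2 : ℕ) : realField R) ≠ 0 := by norm_num
  have hne := (sqrtNegThreePlusSqrtTwo_mk_prime_ne_splitDiscriminantClassCM_iff' hR 2 Nat.prime_two
    (Units.mk0 ((2 : ℕ) : realField R) h0) (by rw [Units.val_mk0])).not
  rw [not_not, not_not] at hne
  have h := (mk_eq_splitDiscriminantClassCM_iff_badPlaces_eq_empty (R := R) (Units.mk0 ((2 : ℕ) : realField R) h0)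
    even_two).1 (hne.2 (Or.inl rfl))
  rwa [Units.val_mk0] at h

/-- `ℚ(√-(3+√2))`: **the shape of `T(ℓ) ∖ {v₂}`** — every bad place of `T(ℓ)` other than the dyadic place `v₂` is a finite ODD
place `u` which is either `𝔭_θ` (the place over `7` containing `θ`; the other place `𝔭'` over `7` is never bad, part 54) or
does not contain `θ` and then contains `ℓ` (63:12); no infinite place is bad (`ℓ > 0`).
[cite: Omeara1963, §63B Example 63:12] [cite: Deligne1982HodgeCycles, §4 (1)] -/
theorem dFour_exists_of_mem_badPlaces_natCast_diff_dyadic (hR : R = X ^ 2 + C 6 * X + C 7) {θₒ : 𝓞 (realField R)}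
    (hθ : (θₒ : realField R) = AdjoinRoot.root (realPolyQ R)) (v₂ : HeightOneSpectrum (𝓞 (realField R)))
    (h2 : (2 : 𝓞 (realField R)) ∈ v₂.asIdeal) (w : HeightOneSpectrum (𝓞 (realField R)))
    (h7w : ((7 : ℕ) : 𝓞 (realField R)) ∈ w.asIdeal) (hθw : θₒ ∈ w.asIdeal) {ℓ : ℕ} (hℓ : ℓ.Prime)
    {x : HeightOneSpectrum (𝓞 (realField R)) ⊕ InfinitePlace (realField R)}
    (hx : x ∈ badPlaces (ℓ : realField R) (AdjoinRoot.root (realPolyQ R)) \ {Sum.inl v₂}) :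
    ∃ u : HeightOneSpectrum (𝓞 (realField R)), x = Sum.inl u ∧ (2 : 𝓞 (realField R)) ∉ u.asIdeal ∧
      Sum.inl u ∈ badPlaces (ℓ : realField R) (AdjoinRoot.root (realPolyQ R)) ∧
      (u = w ∨ (θₒ ∉ u.asIdeal ∧ (ℓ : 𝓞 (realField R)) ∈ u.asIdeal)) := by
  have hK := finrank_realField_quadratic hR
  have hsev : (7 : ℕ).Prime := by norm_num
  have hroots := roots_real_neg_of_quadratic hR (by norm_num) (by norm_num) (by norm_num)
  have hπ : (θₒ + 3) ^ 2 = 2 * 1 := by rw [dFour_sq_eq_two hR hθ, mul_one]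
  obtain ⟨hxT, hxne⟩ := hx
  rcases x with u | u'
  · have h2u : (2 : 𝓞 (realField R)) ∉ u.asIdeal := fun h2u ↦ hxne (by
      rw [Set.mem_singleton_iff, dyadic_unique_of_sq_eq_two_mul_unit hK isUnit_one hπ u v₂ h2u h2])
    refine ⟨u, rfl, h2u, hxT, ?_⟩
    by_cases hθu : θₒ ∈ u.asIdeal
    · -- `7 ∈ u`: `u` is `𝔭_θ = w` or `𝔭'`, and `𝔭'` is never bad
      left
      obtain ⟨w₁, w', -, h7w₁, h7w', hθw₁, h1w', -, -, -, -, hall⟩ := dFour_places_over_seven hR hθ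
      have hw₁ : w = w₁ := by
        rcases hall w h7w with h | h
        · exact h
        · exfalso
          rw [h] at hθw
          exact w'.isPrime.ne_top ((Ideal.eq_top_iff_one _).2 (by
            have e : (1 : 𝓞 (realField R)) = θₒ - (θₒ - 1) := by ring
            rw [e]; exact w'.asIdeal.sub_mem hθw h1w'))
      have h7u : ((7 : ℤ) : 𝓞 (realField R)) ∈ u.asIdeal := intCast_mem_of_root_mem hR hθ u hθu
      rcases hall u (by exact_mod_cast h7u) with h | h
      · rw [h, hw₁]
      · exfalso
        rw [h] at hxT
        exact dFour_inl_notMem_badPlaces_natCast_of_root_sub_one_mem hθ w' h7w' h1w' hℓ hxT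
    · exact Or.inr ⟨hθu, dFour_natCast_mem_of_inl_mem_badPlaces hθ u h2u hθu hℓ hxT⟩
  · exact absurd hxT (inr_notMem_badPlaces_natCast hroots u' hℓ)

/-- **`ℚ(√-(3+√2))` — THE DYADIC PLACE IN CLOSED FORM: `v₂ = (√2) ∈ T(ℓ) ⟺ ℓ ≡ 3 (mod 4)`, for every prime `ℓ`.**
`ℓ = 2`: `T(2) = ∅`.  `ℓ = 7`: `T(7) ∖ {v₂} = {𝔭_θ}` (odd).  `ℓ ≡ ±3 (mod 8)` (inert in `F`): `T(ℓ) ∖ {v₂} ⊆ {𝔭_θ, (ℓ)}` with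
`𝔭_θ ∈ T(ℓ) ⟺ (ℓ|7) = -1` and `(ℓ) ∈ T(ℓ) ⟺ (7|ℓ) = -1`.  `ℓ ≡ ±1 (mod 8)`, `ℓ ≠ 7` (split): `T(ℓ) ∖ {v₂} ⊆ {𝔭_θ, v, v'}` with
`#(T(ℓ) ∩ {v, v'})` odd iff `(7|ℓ) = -1`.  In both cases Hilbert reciprocity (`|T(ℓ)|` even, 71:18) gives
`v₂ ∈ T(ℓ) ⟺ [(ℓ|7) = -1] XOR [(7|ℓ) = -1] ⟺ ℓ ≡ 3 (mod 4)` (§159).  Locally: `(ℓ, θ)_{v₂} = (ℓ, 7)₂ = (-1)^{(ℓ-1)/2}`.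
[cite: Omeara1963, §63B Cor. 63:11a, Example 63:12 and §71D Thm. 71:18] [cite: Deligne1982HodgeCycles, §4 (1) and Cor. 4.2] -/
theorem dFour_inl_mem_badPlaces_natCast_iff_of_mem_two (hR : R = X ^ 2 + C 6 * X + C 7)
    (v₂ : HeightOneSpectrum (𝓞 (realField R))) (h2 : (2 : 𝓞 (realField R)) ∈ v₂.asIdeal) {ℓ : ℕ} (hℓ : ℓ.Prime) :
    Sum.inl v₂ ∈ badPlaces (ℓ : realField R) (AdjoinRoot.root (realPolyQ R)) ↔ ℓ % 4 = 3 := by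
  by_cases hℓ2 : ℓ = 2
  · subst hℓ2
    rw [dFour_badPlaces_two hR]
    exact iff_of_false (Set.notMem_empty _) (by norm_num)
  haveI := Fact.mk hℓ
  have hK := finrank_realField_quadratic hR
  have hsev : (7 : ℕ).Prime := by norm_num
  obtain ⟨hRm, -⟩ := monic_and_natDegree_of_quadratic R hR
  obtain ⟨θₒ, hθ⟩ := exists_ringOfIntegers_coe_eq_root hRm
  obtain ⟨w, w', hww', h7w, h7w', hθw, h1w', -, -, -, -, hall7⟩ := dFour_places_over_seven hR hθ
  have hℓ0 : (ℓ : realField R) ≠ 0 := by exact_mod_cast hℓ.ne_zero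
  -- `v₂ ∈ T(ℓ) ⟺ |T(ℓ) ∖ {v₂}|` odd
  have hpar := mem_badPlaces_iff_odd_ncard_diff_singleton (R := R) (Units.mk0 (ℓ : realField R) hℓ0) (Sum.inl v₂)
  rw [Units.val_mk0] at hpar
  rw [hpar]
  have key := fun x hx ↦ dFour_exists_of_mem_badPlaces_natCast_diff_dyadic hR hθ v₂ h2 w h7w hθw hℓ (x := x) hx
  have h2w : (2 : 𝓞 (realField R)) ∉ w.asIdeal := two_notMem_of_natCast_mem hsev (by norm_num) w h7w
  have hwv₂ : (Sum.inl w : HeightOneSpectrum (𝓞 (realField R)) ⊕ InfinitePlace (realField R)) ≠ Sum.inl v₂ :=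
    fun h ↦ h2w (by rw [Sum.inl_injective h]; exact h2)
  -- membership of `𝔭_θ`
  have hwT := dFour_inl_mem_badPlaces_natCast_iff_of_root_mem hR hθ w h7w hθw hℓ
  by_cases hℓ7 : ℓ = 7
  · subst hℓ7
    refine iff_of_true ?_ (by norm_num)
    have hS : badPlaces ((7 : ℕ) : realField R) (AdjoinRoot.root (realPolyQ R)) \ {Sum.inl v₂} = {Sum.inl w} := by
      refine Set.Subset.antisymm (fun x hx ↦ ?_) ?_
      · obtain ⟨u, rfl, h2u, huT, hu⟩ := key x hx
        rcases hu with huw | ⟨hθu, h7u⟩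
        · rw [huw]; rfl
        · exfalso
          rcases hall7 u h7u with huw | huw'
          · exact hθu (by rw [huw]; exact hθw)
          · rw [huw'] at huT
            exact dFour_inl_notMem_badPlaces_natCast_of_root_sub_one_mem hθ w' h7w' h1w' hsev huT
      · rintro x rfl
        exact ⟨hwT.2 (Or.inr rfl), hwv₂⟩
    rw [hS, Set.ncard_singleton]
    exact odd_one
  have hodd : ℓ % 2 = 1 := (Nat.Prime.mod_two_eq_one_iff_ne_two hℓ).2 hℓ2
  have hℓw : (ℓ : 𝓞 (realField R)) ∉ w.asIdeal := fun h ↦ hℓ7 (prime_natCast_mem_unique hℓ hsev w h h7w)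
  -- `𝔭_θ ∈ T(ℓ) ⟺ ℓ % 7 ∈ {3, 5, 6}` for `ℓ ≠ 7`
  have hwT' : Sum.inl w ∈ badPlaces (ℓ : realField R) (AdjoinRoot.root (realPolyQ R)) ↔
      (ℓ % 7 = 3 ∨ ℓ % 7 = 5 ∨ ℓ % 7 = 6) := by
    rw [hwT]; exact ⟨fun h ↦ h.resolve_right hℓ7, Or.inl⟩
  rw [← xor_nonsquare_mod_seven_not_isSquare_seven_iff hℓ hℓ2 hℓ7, ← hwT']
  by_cases hin : ℓ % 8 = 3 ∨ ℓ % 8 = 5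
  · -- inert: the place `u₀ = (ℓ)` is unique; `T(ℓ) ∖ {v₂} ⊆ {𝔭_θ, (ℓ)}`
    have h20 : (2 : ZMod ℓ) ≠ 0 := by exact_mod_cast natCast_prime_ne_zero_zmod Nat.prime_two hℓ2
    have hn2 : ¬ IsSquare (2 : ZMod ℓ) := by rw [ZMod.exists_sq_eq_two_iff hℓ2]; omega
    have hdisc : ¬ IsSquare (((6 : ℤ) ^ 2 - 4 * 7 : ℤ) : ZMod ℓ) := by
      have e : (((6 : ℤ) ^ 2 - 4 * 7 : ℤ) : ZMod ℓ) = 2 * 2 ^ 2 := by push_cast; norm_num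
      rw [e, isSquare_mul_sq_iff_of_ne_zero h20]; exact hn2
    obtain ⟨u₀, hℓu₀⟩ := exists_place_natCast_mem hK hℓ
    have huniq : ∀ u : HeightOneSpectrum (𝓞 (realField R)), (ℓ : 𝓞 (realField R)) ∈ u.asIdeal → u = u₀ := fun u hu ↦
      eq_of_natCast_mem_of_absNorm_eq_sq hK hℓ u₀ u hℓu₀ hu (absNorm_eq_sq_of_not_isSquare_disc hR hθ hℓ hdisc u₀ hℓu₀)
    have hu₀T := dFour_inl_mem_badPlaces_natCast_iff_of_inert hR hθ hℓ hin u₀ hℓu₀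
    have hwu₀ : w ≠ u₀ := fun h ↦ hℓw (by rw [h]; exact hℓu₀)
    have hu₀v₂ : (Sum.inl u₀ : HeightOneSpectrum (𝓞 (realField R)) ⊕ InfinitePlace (realField R)) ≠ Sum.inl v₂ :=
      fun h ↦ two_notMem_of_natCast_mem hℓ hℓ2 u₀ hℓu₀ (by rw [Sum.inl_injective h]; exact h2)
    have hsub : badPlaces (ℓ : realField R) (AdjoinRoot.root (realPolyQ R)) \ {Sum.inl v₂} ⊆ {Sum.inl w, Sum.inl u₀} := by
      intro x hx
      obtain ⟨u, rfl, -, -, hu⟩ := key x hx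
      rcases hu with huw | ⟨-, hℓu⟩
      · rw [huw]; exact Set.mem_insert _ _
      · rw [huniq u hℓu]; exact Set.mem_insert_of_mem _ (Set.mem_singleton _)
    rw [odd_ncard_diff_singleton_iff_of_subset_pair hwv₂ hu₀v₂ (fun h ↦ hwu₀ (Sum.inl_injective h)) hsub, hu₀T]
  · -- split: `ℓ ≡ ±1 (mod 8)`, `ℓ ≠ 7`; `T(ℓ) ∖ {v₂} ⊆ {𝔭_θ, v, v'}`
    have hsp : ℓ % 8 = 1 ∨ ℓ % 8 = 7 := by omega
    obtain ⟨v, v', hvv', hℓv, hℓv', hall, hfib⟩ := dFour_fibre_iff_isSquare_seven hR hθ hℓ hsp hℓ7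
    have hwv : w ≠ v := fun h ↦ hℓw (by rw [h]; exact hℓv)
    have hwv' : w ≠ v' := fun h ↦ hℓw (by rw [h]; exact hℓv')
    have hvv₂ : (Sum.inl v : HeightOneSpectrum (𝓞 (realField R)) ⊕ InfinitePlace (realField R)) ≠ Sum.inl v₂ :=
      fun h ↦ two_notMem_of_natCast_mem hℓ hℓ2 v hℓv (by rw [Sum.inl_injective h]; exact h2)
    have hv'v₂ : (Sum.inl v' : HeightOneSpectrum (𝓞 (realField R)) ⊕ InfinitePlace (realField R)) ≠ Sum.inl v₂ :=
      fun h ↦ two_notMem_of_natCast_mem hℓ hℓ2 v' hℓv' (by rw [Sum.inl_injective h]; exact h2)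
    have hsub : badPlaces (ℓ : realField R) (AdjoinRoot.root (realPolyQ R)) \ {Sum.inl v₂} ⊆
        {Sum.inl w, Sum.inl v, Sum.inl v'} := by
      intro x hx
      obtain ⟨u, rfl, -, -, hu⟩ := key x hx
      rcases hu with huw | ⟨-, hℓu⟩
      · rw [huw]; exact Set.mem_insert _ _
      · rcases hall u hℓu with huv | huv'
        · rw [huv]; exact Set.mem_insert_of_mem _ (Set.mem_insert _ _)
        · rw [huv']; exact Set.mem_insert_of_mem _ (Set.mem_insert_of_mem _ (Set.mem_singleton _))
    rw [odd_ncard_diff_singleton_iff_of_subset_triple hwv₂ hvv₂ hv'v₂ (fun h ↦ hwv (Sum.inl_injective h))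
      (fun h ↦ hwv' (Sum.inl_injective h)) (fun h ↦ hvv' (Sum.inl_injective h)) hsub]
    -- `Xor (v ∈ T) (v' ∈ T) ⟺ ¬ (v ∈ T ↔ v' ∈ T) ⟺ ¬ IsSquare 7`
    rw [xor_iff_not_iff (Sum.inl v ∈ _) (Sum.inl v' ∈ _), hfib]

/-- `ℚ(√-(3+√2))`: **`T(7) = {v₂, 𝔭_θ}`** — the row of `7` is the row `{(√2), 𝔭_θ}` of the census table (`= T(3)`).
[cite: Omeara1963, §71D Thm. 71:18] [cite: Deligne1982HodgeCycles, §4 (1)] -/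
theorem dFour_badPlaces_seven (hR : R = X ^ 2 + C 6 * X + C 7) {θₒ : 𝓞 (realField R)}
    (hθ : (θₒ : realField R) = AdjoinRoot.root (realPolyQ R)) (v₂ : HeightOneSpectrum (𝓞 (realField R)))
    (h2 : (2 : 𝓞 (realField R)) ∈ v₂.asIdeal) (w : HeightOneSpectrum (𝓞 (realField R)))
    (h7w : ((7 : ℕ) : 𝓞 (realField R)) ∈ w.asIdeal) (hθw : θₒ ∈ w.asIdeal) :
    badPlaces ((7 : ℕ) : realField R) (AdjoinRoot.root (realPolyQ R)) = {Sum.inl v₂, Sum.inl w} := by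
  have hsev : (7 : ℕ).Prime := by norm_num
  obtain ⟨w₁, w', -, h7w₁, h7w', hθw₁, h1w', -, -, -, -, hall7⟩ := dFour_places_over_seven hR hθ
  have hv₂ := (dFour_inl_mem_badPlaces_natCast_iff_of_mem_two hR v₂ h2 hsev).2 (by norm_num)
  have hw := (dFour_inl_mem_badPlaces_natCast_iff_of_root_mem hR hθ w h7w hθw hsev).2 (Or.inr rfl)
  refine Set.Subset.antisymm (fun x hx ↦ ?_) ?_
  · by_cases hxv : x = Sum.inl v₂
    · rw [hxv]; exact Set.mem_insert _ _
    · obtain ⟨u, rfl, -, huT, hu⟩ :=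
        dFour_exists_of_mem_badPlaces_natCast_diff_dyadic hR hθ v₂ h2 w h7w hθw hsev (x := x) ⟨hx, hxv⟩
      rcases hu with huw | ⟨hθu, h7u⟩
      · rw [huw]; exact Set.mem_insert_of_mem _ (Set.mem_singleton _)
      · exfalso
        rcases hall7 u h7u with huw | huw'
        · rcases hall7 w h7w with hww | hww'
          · exact hθu (by rw [huw, ← hww]; exact hθw)
          · rw [hww'] at hθw
            exact w'.isPrime.ne_top ((Ideal.eq_top_iff_one _).2 (by
              have e : (1 : 𝓞 (realField R)) = θₒ - (θₒ - 1) := by ring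
              rw [e]; exact w'.asIdeal.sub_mem hθw h1w'))
        · rw [huw'] at huT
          exact dFour_inl_notMem_badPlaces_natCast_of_root_sub_one_mem hθ w' h7w' h1w' hsev huT
  · rintro x (rfl | rfl)
    · exact hv₂
    · exact hw

/-! ### §161 `ℚ(√-(3+√2))`: the dyadic place against `T(n)`, `T(c)` -/

/-- `ℚ(√-(3+√2))`: **`T(2n) = T(n)`** (`T(2) = ∅`, `T(ab) = T(a) ∆ T(b)`). [cite: Deligne1982HodgeCycles, §4 (1)]
[cite: Omeara1963, §63B (multiplicativity of the symbol)] -/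
theorem dFour_badPlaces_two_mul (hR : R = X ^ 2 + C 6 * X + C 7) {n : ℕ} (hn : n ≠ 0) :
    badPlaces ((2 * n : ℕ) : realField R) (AdjoinRoot.root (realPolyQ R)) =
      badPlaces (n : realField R) (AdjoinRoot.root (realPolyQ R)) := by
  have h2 : ((2 : ℕ) : realField R) ≠ 0 := by norm_num
  have hn' : (n : realField R) ≠ 0 := by exact_mod_cast hn
  rw [Nat.cast_mul, badPlaces_mul h2 hn' root_realPolyQ_ne_zero, dFour_badPlaces_two hR, ← Set.bot_eq_empty, bot_symmDiff]

/-- **`ℚ(√-(3+√2))`: `v₂ ∈ T(n) ⟺ n ≡ 3 (mod 4)` for every ODD `n ≥ 1`** (multiplicativity: for odd `a`, `b`,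
`ab ≡ 3 (mod 4)` iff exactly one of `a`, `b` is `≡ 3 (mod 4)`).  With `T(2n) = T(n)`: `v₂ ∈ T(n)` iff the odd part of `n` is
`≡ 3 (mod 4)`. [cite: Omeara1963, §63B and §71D Thm. 71:18] [cite: Deligne1982HodgeCycles, §4 (1)] -/
theorem dFour_inl_mem_badPlaces_natCast_iff_of_mem_two_of_odd (hR : R = X ^ 2 + C 6 * X + C 7)
    (v₂ : HeightOneSpectrum (𝓞 (realField R))) (h2 : (2 : 𝓞 (realField R)) ∈ v₂.asIdeal) {n : ℕ} (hn : Odd n) :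
    Sum.inl v₂ ∈ badPlaces (n : realField R) (AdjoinRoot.root (realPolyQ R)) ↔ n % 4 = 3 := by
  induction n using Nat.recOnMul with
  | zero => exact absurd hn (by decide)
  | one =>
    rw [Nat.cast_one, badPlaces_one]
    exact iff_of_false (Set.notMem_empty _) (by norm_num)
  | prime p hp => exact dFour_inl_mem_badPlaces_natCast_iff_of_mem_two hR v₂ h2 hp
  | mul a b iha ihb =>
    have ha : Odd a := (Nat.odd_mul.1 hn).1
    have hb : Odd b := (Nat.odd_mul.1 hn).2
    have ha0 : a ≠ 0 := by rintro rfl; exact absurd ha (by decide)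
    have hb0 : b ≠ 0 := by rintro rfl; exact absurd hb (by decide)
    rw [Nat.cast_mul, badPlaces_mul (by exact_mod_cast ha0) (by exact_mod_cast hb0) root_realPolyQ_ne_zero,
      Set.mem_symmDiff, iha ha, ihb hb, Nat.mul_mod]
    have ha4 : a % 4 = 1 ∨ a % 4 = 3 := by obtain ⟨i, rfl⟩ := ha; omega
    have hb4 : b % 4 = 1 ∨ b % 4 = 3 := by obtain ⟨j, rfl⟩ := hb; omega
    rcases ha4 with ha4 | ha4 <;> rcases hb4 with hb4 | hb4 <;> rw [ha4, hb4] <;> decide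

/-- **`ℚ(√-(3+√2))`: for `c ∈ ℚ_{>0}`, `v₂ ∈ T(c)` iff the number of prime factors `ℓ ≡ 3 (mod 4)` of `num(c)·den(c)`,
counted with multiplicity, is odd** (parity of the prime support, part 46). [cite: Deligne1982HodgeCycles, §4 (1)]
[cite: Omeara1963, §63B] -/
theorem dFour_inl_mem_badPlaces_ratCast_iff_of_mem_two (hR : R = X ^ 2 + C 6 * X + C 7)
    (v₂ : HeightOneSpectrum (𝓞 (realField R))) (h2 : (2 : 𝓞 (realField R)) ∈ v₂.asIdeal) {c : ℚ} (hc : 0 < c) :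
    Sum.inl v₂ ∈ badPlaces (c : realField R) (AdjoinRoot.root (realPolyQ R)) ↔
      Odd ((c.num.natAbs * c.den).factorization.sum fun ℓ e ↦ if ℓ % 4 = 3 then e else 0) :=
  mem_badPlaces_ratCast_iff_odd_sum_factorization _ (fun ℓ ↦ ℓ % 4 = 3)
    (fun _ hℓ ↦ dFour_inl_mem_badPlaces_natCast_iff_of_mem_two hR v₂ h2 hℓ) hc

end DFourDyadic

end Summit.HodgeConjecture.HodgeConjecture.Ring2.WeilCoverageCM

end
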